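import Literature.Topology.FourManifolds.SubsphereParam
import Literature.Topology.FourManifolds.HeightDictionary
import HarnessLib

/-!
# The Morse data of the sub-configuration of the capped-ball step

Topic `Literature/Topology/FourManifolds`; fact seat of Alexander's theorem
(`provefact-Literature.Topology.FourManifolds.SphereEmbedding.schoenflies_exists_ball`, Schultens
(2014), Thm. 3.2.5).  **Everything in this file is proved; no definitions, no named facts.**

The smoothed sphere `S₁ = W` of the step has "the same saddles as the absorbed disc and one new
critical point" (Schultens (2014), proof of Thm. 3.2.5, PDF p. 45: the smoothing isotopy "adds
one critical point").  In the fact seat's `F`-side bookkeeping (`HeightDictionary.lean`):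

* §1 germs of `G_B` along `W` (`= F` near far points of `E₂`); in the closed box the filled
  function has positive horizontal radial derivative at its zeros (`fderiv_fillFun_horizontal_pos`),
  so neither it nor the wall has horizontal points there;
* §2 `CappedBallLid.horizontal_iff` — **the horizontal points of `G_B` on `W` are the apex
  `(0, 0, s)` and the far horizontal points of `F` on `E₂`**; at the apex `D²G_B|e₂ᗮ` is positive
  definite (`fderiv_fderiv_subFun_apex_pos`);
* §3 `CappedBallLid.isMorse_sub` — **the height on the sub-sphere is Morse** if it is on the
  original sphere; `CappedBallLid.saddleSet_eq` — **the saddles (indefinite horizontal points)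
  of the sub-sphere are exactly the far saddles on `E₂`**; `horizontal_mem_iff` — the horizontal
  points of the original sphere are far points of `E₁` or `E₂`.

## References
* J. Schultens, *Introduction to 3-Manifolds*, GSM 151, AMS (2014), Thm. 3.2.5, PDF pp. 42–45.
* J. Milnor, *Morse Theory*, Princeton (1963), §§2–3.
-/

open scoped RealInnerProductSpace Topology Manifold ContDiff
open Set Filter Metric Function

noncomputable section

namespace Literature.Topology.FourManifolds

namespace CappedBallLid

variable {F : EuclideanSpace ℝ (Fin 3) → ℝ} {P : ℝ → ℝ} {E₁ E₂ : Set (EuclideanSpace ℝ (Fin 3))}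
  {w₀ η₀ ε₀ s δ : ℝ}

/-! ### §1 Germs of the sub-sphere function along the sub-sphere -/

/-- **Off the closed box, near a point with `F ≤ 1`, the filled function is `F`.** [folklore] -/
theorem fillFun_eventuallyEq_of_not_mem (hP : Admissible P) (hN : StepNF F E₁ E₂ w₀ η₀ ε₀)
    (hS : StepScale s δ w₀ η₀) {x : EuclideanSpace ℝ (Fin 3)} (hxB : x ∉ closedBox s) (hFx : F x ≤ 1) :
    fillFun F P s δ ((1 + s) ^ 2 + ε₀ + 2) =ᶠ[𝓝 x] F := by
  obtain ⟨hs, hs1, hsw, hsη, hδ, hδs⟩ := scales hS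
  have hε₀ := hN.hε₀
  have hopen : IsOpen ((closedBox s)ᶜ ∩ {y | F y < ε₀ + 1}) :=
    isClosed_closedBox.isOpen_compl.inter (isOpen_lt hN.hF.continuous continuous_const)
  filter_upwards [hopen.mem_nhds ⟨hxB, by show F x < ε₀ + 1; linarith⟩] with y hy
  exact fillFun_eq_of_not_mem hP.hP0 hP.hPge hs hδ (by linarith) hy.1 (le_of_lt hy.2)

/-- **Near a far point of `E₂` the sub-sphere function is `F`.** [folklore] -/
theorem subFun_eventuallyEq_of_far (hP : Admissible P) (hN : StepNF F E₁ E₂ w₀ η₀ ε₀)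
    (hS : StepScale s δ w₀ η₀) {x : EuclideanSpace ℝ (Fin 3)} (hxB : x ∉ closedBox s) (hFx : F x = 0) :
    subFun F P s δ ((1 + s) ^ 2 + ε₀ + 2) =ᶠ[𝓝 x] F :=
  (subFun_eventuallyEq_fillFun hP hN hS (Or.inl hxB)).trans
    (fillFun_eventuallyEq_of_not_mem hP hN hS hxB (by rw [hFx]; exact zero_le_one))

/-- **In the closed box, at a zero of the filled function, the horizontal radial derivative of the
filled function is positive**: `DF₂(x)(x₀, x₁, 0) > 0` (a convex combination of `2ρ²` and of the
horizontal radial derivative of `w`, a multiple `≥ 2s ρ²` of it; `ρ² ≥ 1`). [folklore] -/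
theorem fderiv_fillFun_horizontal_pos (hP : Admissible P) (hN : StepNF F E₁ E₂ w₀ η₀ ε₀)
    (hS : StepScale s δ w₀ η₀) {x : EuclideanSpace ℝ (Fin 3)} (hxB : x ∈ closedBox s)
    (hx : fillFun F P s δ ((1 + s) ^ 2 + ε₀ + 2) x = 0) {u : EuclideanSpace ℝ (Fin 3)}
    (hu0 : u 0 = x 0) (hu1 : u 1 = x 1) (hu2 : u 2 = 0) :
    0 < fderiv ℝ (fillFun F P s δ ((1 + s) ^ 2 + ε₀ + 2)) x u := by
  obtain ⟨hs, hs1, hsw, hsη, hδ, hδs⟩ := scales hS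
  set M := (1 + s) ^ 2 + ε₀ + 2 with hM
  have hε₀ := hN.hε₀
  have hM0 : 0 ≤ M := by positivity
  have hPdiff : Differentiable ℝ P := hP.differentiable
  have hFd : Differentiable ℝ F := hN.hF.differentiable (by simp)
  obtain ⟨h1, h2, h3⟩ := hxB
  have hhsq : 1 ≤ hsq x := one_le_hsq_of_fillFun_eq_zero hP hN hS hx ⟨h1, h2, h3⟩
  obtain ⟨-, hDF⟩ := fderiv_eq_dhsq_of_mem_box hs hs1 hsw (by linarith) hN.hNFa hhsq h1 h2 h3
  have hderiv := (hasFDerivAt_fillFun hPdiff hδ.ne' hFd hP.hP x (s := s) (M := M)).fderiv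
  rw [hderiv]
  simp only [add_apply, FunLike.coe_smul, Pi.smul_apply, smul_eq_mul, hDF, dhsq_apply,
    fderiv_fillWeight_apply_of_coord_two_eq_zero hPdiff hs x hu2, hu0, hu1]
  set θ := deriv P ((F x - (fillWeight P s δ M x - 1)) / δ) with hθ
  obtain ⟨hθ0, hθ1⟩ := hP.hPd ((F x - (fillWeight P s δ M x - 1)) / δ)
  have hcoef : 2 * s ≤ (2 * s * (1 - deriv P ((rimFun s x - topFun s x) / (s / 8))) +
      2 * deriv P ((rimFun s x - topFun s x) / (s / 8))) +
      2 * M * (deriv (latCutoff s) (hsq x) * (1 - vertCutoff s (x 2))) := by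
    have h1 := two_mul_le_horizCoeff (s := s) (P := P) hP.hPd (by linarith) x
    have h2 : 0 ≤ deriv (latCutoff s) (hsq x) * (1 - vertCutoff s (x 2)) :=
      mul_nonneg (deriv_latCutoff_nonneg hs _) (sub_nonneg.2 (vertCutoff_mem_Icc hs _).2)
    nlinarith [mul_nonneg hM0 h2]
  have hh : x 0 * x 0 + x 1 * x 1 = hsq x := by simp [hsq, sq]
  have hh2 : 2 * x 0 * x 0 + 2 * x 1 * x 1 = 2 * hsq x := by simp [hsq, sq]; ring
  rw [hh, hh2]
  set C := (2 * s * (1 - deriv P ((rimFun s x - topFun s x) / (s / 8))) +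
      2 * deriv P ((rimFun s x - topFun s x) / (s / 8))) +
      2 * M * (deriv (latCutoff s) (hsq x) * (1 - vertCutoff s (x 2))) with hC
  -- `(1 - θ) 2ρ² + θ C ρ² ≥ min(2, 2s) ρ² > 0`
  have : 2 * s * hsq x ≤ (1 - θ) * (2 * hsq x) + θ * (C * hsq x) := by
    nlinarith [mul_nonneg hθ0 (by linarith : (0:ℝ) ≤ hsq x),
      mul_nonneg (sub_nonneg.2 hθ1) (by linarith : (0:ℝ) ≤ hsq x),
      mul_le_mul_of_nonneg_left hcoef (mul_nonneg hθ0 (by linarith : (0:ℝ) ≤ hsq x))]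
  nlinarith

/-- **A zero of the filled function in the closed box is not a horizontal point** of the filled
function (its differential is not a multiple of the height differential). [folklore] -/
theorem fderiv_fillFun_ne_smul (hP : Admissible P) (hN : StepNF F E₁ E₂ w₀ η₀ ε₀)
    (hS : StepScale s δ w₀ η₀) {x : EuclideanSpace ℝ (Fin 3)} (hxB : x ∈ closedBox s)
    (hx : fillFun F P s δ ((1 + s) ^ 2 + ε₀ + 2) x = 0) (c : ℝ) :
    fderiv ℝ (fillFun F P s δ ((1 + s) ^ 2 + ε₀ + 2)) x ≠
      c • innerSL ℝ (EuclideanSpace.single (2 : Fin 3) (1 : ℝ)) := by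
  intro h
  obtain ⟨u, hu0, hu1, hu2⟩ := exists_horizontal x
  have hpos := fderiv_fillFun_horizontal_pos hP hN hS hxB hx hu0 hu1 hu2
  rw [h, FunLike.coe_smul, Pi.smul_apply, innerSL_single_two] at hpos
  simp [hu2] at hpos

/-- **The wall is not horizontal**: a zero `x` of `F` in the closed box has `DF(x) = dhsq(x)`
with `ρ² = 1`, not a multiple of the height differential. [folklore] -/
theorem fderiv_ne_smul_of_mem_closedBox (hN : StepNF F E₁ E₂ w₀ η₀ ε₀) (hS : StepScale s δ w₀ η₀)
    {x : EuclideanSpace ℝ (Fin 3)} (hxB : x ∈ closedBox s) (hx : F x = 0) (c : ℝ) :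
    fderiv ℝ F x ≠ c • innerSL ℝ (EuclideanSpace.single (2 : Fin 3) (1 : ℝ)) := by
  obtain ⟨hs, hs1, hsw, hsη, -, -⟩ := scales hS
  obtain ⟨h1, h2, h3⟩ := hxB
  have hh : hsq x = 1 := hN.hsq_eq_one hx (by nlinarith) (abs_le.2 ⟨by linarith, by linarith⟩)
  obtain ⟨-, hDF⟩ := fderiv_eq_dhsq_of_mem_box hs hs1 hsw (by linarith) hN.hNFa hh.ge h1 h2 h3
  intro h
  obtain ⟨u, hu0, hu1, hu2⟩ := exists_horizontal x
  have := congrArg (fun A : EuclideanSpace ℝ (Fin 3) →L[ℝ] ℝ => A u) h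
  simp only [hDF, dhsq_apply, FunLike.coe_smul, Pi.smul_apply, innerSL_single_two, hu0, hu1] at this
  simp [hu2] at this
  have hh' : x 0 * x 0 + x 1 * x 1 = 1 := by rw [← hh]; simp [hsq, sq]
  nlinarith

/-! ### §2 Horizontal points of the sub-sphere function on the sub-sphere -/

/-- **The horizontal points of `G_B` on `W` are the apex and the far horizontal points of `F` on
`E₂`.**  At a point of `W` in the open lid zone `G_B = G` near the point, whose only horizontal
zero is the apex (`eq_apex_of_fderiv_lidFun_eq_smul`); at the other points of `W` in the closed
box `G_B = F₂` near the point, not horizontal there (`fderiv_fillFun_ne_smul`); off the box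
`G_B = F` near the point. [folklore] -/
theorem horizontal_iff (hP : Admissible P) (hN : StepNF F E₁ E₂ w₀ η₀ ε₀) (hS : StepScale s δ w₀ η₀)
    {x : EuclideanSpace ℝ (Fin 3)} (hx : x ∈ subSphere F P E₁ s δ ε₀) :
    (∃ c : ℝ, fderiv ℝ (subFun F P s δ ((1 + s) ^ 2 + ε₀ + 2)) x =
        c • innerSL ℝ (EuclideanSpace.single (2 : Fin 3) (1 : ℝ))) ↔
      ((x 0 = 0 ∧ x 1 = 0 ∧ x 2 = s) ∨
        (x ∈ E₂ ∧ x ∉ closedBox s ∧ ∃ c : ℝ, fderiv ℝ F x =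
          c • innerSL ℝ (EuclideanSpace.single (2 : Fin 3) (1 : ℝ)))) := by
  obtain ⟨hs, hs1, hsw, hsη, hδ, hδs⟩ := scales hS
  set M := (1 + s) ^ 2 + ε₀ + 2 with hM
  have hxW := hx
  rw [subSphere_eq hP hN hS] at hx
  -- three kinds of points
  rcases hx with (⟨hG, hz⟩ | ⟨hF2, hz, hxB⟩) | ⟨hx2, hxB⟩
  · -- lid piece: either in the open lid zone (`G_B = G` near `x`) or at `x₂ ≤ -2s` (collar: `G_B = F₂`)
    obtain ⟨hzs, hhsq⟩ := bounds_of_lidFun_eq_zero hP hS hG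
    have hxB : x ∈ closedBox s := ⟨by nlinarith, by linarith, by linarith⟩
    by_cases hz2 : -(5 * s / 2) < x 2
    · -- `G_B = G` near `x`
      have hev : subFun F P s δ M =ᶠ[𝓝 x] lidFun P s :=
        subFun_eventuallyEq_lidFun hP hN hS (by nlinarith) (by linarith) (by linarith) (Or.inl hz2)
      rw [hev.fderiv_eq]
      constructor
      · rintro ⟨c, hc⟩
        exact Or.inl (eq_apex_of_fderiv_lidFun_eq_smul hP.hP0 hP.hPle hP.differentiable hP.hPd hs
          (by linarith) hG hc)
      · rintro (⟨h0, h1, h2⟩ | ⟨-, hxB', -⟩)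
        · exact ⟨1, by rw [one_smul]; exact fderiv_lidFun_apex hP.hP0 hs (by linarith) h0 h1 h2⟩
        · exact absurd hxB hxB'
    · push Not at hz2
      -- collar: `G_B = F₂` near `x`, and `F₂ x = 0`
      have hz2' : x 2 ≤ -2 * s := by linarith
      have h18 := hsq_ge_of_lidFun_eq_zero hP hS hG hz2'
      have hev : subFun F P s δ M =ᶠ[𝓝 x] fillFun F P s δ M :=
        subFun_eventuallyEq_fillFun hP hN hS (Or.inr (Or.inr ⟨by linarith, by linarith, by nlinarith⟩))
      have hF2 : fillFun F P s δ M x = 0 := by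
        rw [← fillFun_eq_lidFun_of_collar hP hN hS (by linarith) (by nlinarith) hz hz2'] at hG; exact hG
      rw [hev.fderiv_eq]
      constructor
      · rintro ⟨c, hc⟩; exact absurd hc (fderiv_fillFun_ne_smul hP hN hS hxB hF2 c)
      · rintro (⟨h0, h1, h2⟩ | ⟨-, hxB', -⟩)
        · exfalso; linarith
        · exact absurd hxB hxB'
  · -- low piece: `G_B = F₂` near `x`
    have hev : subFun F P s δ M =ᶠ[𝓝 x] fillFun F P s δ M := by
      by_cases hz3 : x 2 < -3 * s
      · exact subFun_eventuallyEq_fillFun hP hN hS (Or.inr (Or.inl hz3))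
      · push Not at hz3
        obtain ⟨hin, hlat⟩ := collar_of_fillFun_eq_zero hP hN hS hF2 hxB hz3 (by linarith)
        refine subFun_eventuallyEq_fillFun hP hN hS (Or.inr (Or.inr ⟨by linarith, ?_, ?_⟩))
        · -- strictness of the inner bound: `ρ² ≥ 1 > 1 - s/4`
          have := one_le_hsq_of_fillFun_eq_zero hP hN hS hF2 hxB
          linarith
        · -- strictness of the lateral bound
          rcases hlat.lt_or_eq with hlt | heq
          · exact hlt
          · exfalso
            -- at `ρ² = (1+2s)²` in the collar `F₂ = G > 0`
            have hGeq := fillFun_eq_lidFun_of_collar hP hN hS hin hlat hz3 (by linarith)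
            rw [hGeq] at hF2
            have := lidFun_pos_of_sq_lt_hsq hP.hPge hs (x := x) (by rw [heq]; nlinarith)
            linarith
    rw [hev.fderiv_eq]
    constructor
    · rintro ⟨c, hc⟩; exact absurd hc (fderiv_fillFun_ne_smul hP hN hS hxB hF2 c)
    · rintro (⟨h0, h1, h2⟩ | ⟨-, hxB', -⟩)
      · exfalso; linarith
      · exact absurd hxB hxB'
  · -- far part of `E₂`: `G_B = F` near `x`
    have hFx : F x = 0 := hN.eq_zero_of_mem_right hx2
    rw [(subFun_eventuallyEq_of_far hP hN hS hxB hFx).fderiv_eq]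
    constructor
    · intro h; exact Or.inr ⟨hx2, hxB, h⟩
    · rintro (⟨h0, h1, h2⟩ | ⟨-, -, h⟩)
      · exfalso
        exact hxB ⟨by simp [hsq, h0, h1]; nlinarith, by rw [h2]; linarith, by rw [h2]; linarith⟩
      · exact h

/-- **The apex is in the sub-sphere**, and near it `G_B = G`. [folklore] -/
theorem apex_mem (hP : Admissible P) (hN : StepNF F E₁ E₂ w₀ η₀ ε₀) (hS : StepScale s δ w₀ η₀)
    {x : EuclideanSpace ℝ (Fin 3)} (h0 : x 0 = 0) (h1 : x 1 = 0) (h2 : x 2 = s) :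
    x ∈ subSphere F P E₁ s δ ε₀ ∧ subFun F P s δ ((1 + s) ^ 2 + ε₀ + 2) =ᶠ[𝓝 x] lidFun P s := by
  obtain ⟨hs, hs1, -, -, -, -⟩ := scales hS
  have hh : hsq x = 0 := by simp [hsq, h0, h1]
  have ha : topFun s x = 0 := by unfold topFun; rw [h2, hh]; ring
  exact ⟨domeDisc_subset hP hN hS ha (by rw [hh]; linarith),
    subFun_eventuallyEq_lidFun hP hN hS (by rw [hh]; positivity) (by rw [h2]; linarith) (by rw [h2]; linarith)
      (Or.inl (by rw [h2]; linarith))⟩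

/-- **At the apex `D²G_B|e₂ᗮ` is positive definite.** [folklore] -/
theorem fderiv_fderiv_subFun_apex_pos (hP : Admissible P) (hN : StepNF F E₁ E₂ w₀ η₀ ε₀)
    (hS : StepScale s δ w₀ η₀) {x : EuclideanSpace ℝ (Fin 3)} (h0 : x 0 = 0) (h1 : x 1 = 0) (h2 : x 2 = s)
    {w : EuclideanSpace ℝ (Fin 3)} (hw : ⟪EuclideanSpace.single (2 : Fin 3) (1 : ℝ), w⟫ = 0) (hw0 : w ≠ 0) :
    0 < fderiv ℝ (fderiv ℝ (subFun F P s δ ((1 + s) ^ 2 + ε₀ + 2))) x w w := by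
  obtain ⟨hs, hs1, -, -, -, -⟩ := scales hS
  rw [(apex_mem hP hN hS h0 h1 h2).2.fderiv.fderiv_eq]
  exact fderiv_fderiv_lidFun_apex_pos hP.hP0 hs (by linarith) h0 h1 h2 hw hw0

/-! ### §3 The Morse data of the sub-configuration -/

section Morse

variable {f fB : sphere (0 : EuclideanSpace ℝ (Fin 3)) 1 → EuclideanSpace ℝ (Fin 3)}

/-- **The height on the sub-sphere is a Morse function** if the height on the original sphere is:
by the dictionary (`HeightDictionary.isMorse_inner_comp_iff`) the condition is the nondegeneracy
of `D²G_B|e₂ᗮ` at the horizontal points of `G_B` on `W` — the apex (positive definite) and the far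
horizontal points of `F` on `E₂`, where `G_B = F` to all orders and the condition is that for the
original sphere. [folklore] -/
theorem isMorse_sub (hP : Admissible P) (hN : StepNF F E₁ E₂ w₀ η₀ ε₀) (hS : StepScale s δ w₀ η₀)
    (hf : Manifold.IsSmoothEmbedding (𝓡 2) 𝓘(ℝ, EuclideanSpace ℝ (Fin 3)) ∞ f)
    (hZ : ∀ y, F (f y) = 0) (hE₂' : E₂ ⊆ range f)
    (hMorse : IsMorse (𝓡 2) (fun y => ⟪EuclideanSpace.single (2 : Fin 3) (1 : ℝ), f y⟫))
    (hfB : Manifold.IsSmoothEmbedding (𝓡 2) 𝓘(ℝ, EuclideanSpace ℝ (Fin 3)) ∞ fB)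
    (hWB : range fB = subSphere F P E₁ s δ ε₀) :
    IsMorse (𝓡 2) (fun y => ⟪EuclideanSpace.single (2 : Fin 3) (1 : ℝ), fB y⟫) := by
  obtain ⟨hs, hs1, -, -, -, -⟩ := scales hS
  set M := (1 + s) ^ 2 + ε₀ + 2 with hM
  set v : EuclideanSpace ℝ (Fin 3) := EuclideanSpace.single (2 : Fin 3) (1 : ℝ) with hv
  have hv0 : v ≠ 0 := by
    intro h; have := congrArg (fun w : EuclideanSpace ℝ (Fin 3) => w 2) h; simp [hv] at this
  have hdim : Module.finrank ℝ (EuclideanSpace ℝ (Fin 3)) = 2 + 1 := by simp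
  have hGBs : ContDiff ℝ ∞ (subFun F P s δ M) := contDiff_subFun hN.hF hP.hP
  have hmemW : ∀ y, fB y ∈ subSphere F P E₁ s δ ε₀ := fun y => by rw [← hWB]; exact mem_range_self y
  have hmemZ : ∀ y, F (f y) = 0 := hZ
  -- the dictionary for the original sphere (⇒): nondegeneracy at the horizontal points of `F`
  have hsepF := (HeightDictionary.isMorse_inner_comp_iff hdim hf.contMDiff
    (fun x => injective_mfderiv_of_isImmersionAt' (hf.isImmersion.isImmersionAt x))
    (hN.hF.of_le (by norm_cast)) hmemZ (fun y => hN.hreg _ (hmemZ y)) hv0).1 hMorse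
  -- the dictionary for the sub-sphere (⇐)
  refine (HeightDictionary.isMorse_inner_comp_iff hdim hfB.contMDiff
    (fun x => injective_mfderiv_of_isImmersionAt' (hfB.isImmersion.isImmersionAt x))
    (hGBs.of_le (by norm_cast)) (fun y => (hmemW y).2)
    (fun y => fderiv_subFun_ne_zero_of_mem hP hN hS (hmemW y)) hv0).2 ?_
  intro x c hDF w hw hker
  rcases (horizontal_iff hP hN hS (hmemW x)).1 ⟨c, hDF⟩ with ⟨h0, h1, h2⟩ | ⟨hE₂, hB, c', hc'⟩
  · -- the apex: positive definite, so the kernel vector is `0`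
    by_contra hw0
    have hpos := fderiv_fderiv_subFun_apex_pos hP hN hS h0 h1 h2 hw hw0
    have := hker w hw
    linarith
  · -- a far point: `G_B = F` to all orders; `fB x = f y`
    have hFx : F (fB x) = 0 := hN.eq_zero_of_mem_right hE₂
    obtain ⟨y, hy⟩ : fB x ∈ range f := hE₂' hE₂
    have hev := subFun_eventuallyEq_of_far hP hN hS hB hFx
    have hD2 : fderiv ℝ (fderiv ℝ (subFun F P s δ M)) (fB x) = fderiv ℝ (fderiv ℝ F) (fB x) :=
      hev.fderiv.fderiv_eq
    rw [← hy] at hc' hD2 hker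
    refine hsepF y c' hc' w hw fun w' hw' => ?_
    have := hker w' hw'
    rw [hD2] at this
    exact this

/-- **The saddles of the sub-sphere are the far saddles of `E₂`.**  The set of indefinite
horizontal points of `G_B` on `W` equals the set of indefinite horizontal points of `F` on
`E₂ ∖ closedBox` (the apex is definite). [folklore] -/
theorem saddleSet_eq (hP : Admissible P) (hN : StepNF F E₁ E₂ w₀ η₀ ε₀) (hS : StepScale s δ w₀ η₀) :
    {p ∈ subSphere F P E₁ s δ ε₀ |
      (∃ c : ℝ, fderiv ℝ (subFun F P s δ ((1 + s) ^ 2 + ε₀ + 2)) p =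
        c • innerSL ℝ (EuclideanSpace.single (2 : Fin 3) (1 : ℝ))) ∧
      (∃ w, ⟪EuclideanSpace.single (2 : Fin 3) (1 : ℝ), w⟫ = 0 ∧
        fderiv ℝ (fderiv ℝ (subFun F P s δ ((1 + s) ^ 2 + ε₀ + 2))) p w w < 0) ∧
      ∃ w, ⟪EuclideanSpace.single (2 : Fin 3) (1 : ℝ), w⟫ = 0 ∧
        0 < fderiv ℝ (fderiv ℝ (subFun F P s δ ((1 + s) ^ 2 + ε₀ + 2))) p w w} =
    {p ∈ E₂ \ closedBox s |
      (∃ c : ℝ, fderiv ℝ F p = c • innerSL ℝ (EuclideanSpace.single (2 : Fin 3) (1 : ℝ))) ∧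
      (∃ w, ⟪EuclideanSpace.single (2 : Fin 3) (1 : ℝ), w⟫ = 0 ∧ fderiv ℝ (fderiv ℝ F) p w w < 0) ∧
      ∃ w, ⟪EuclideanSpace.single (2 : Fin 3) (1 : ℝ), w⟫ = 0 ∧ 0 < fderiv ℝ (fderiv ℝ F) p w w} := by
  obtain ⟨hs, hs1, -, -, -, -⟩ := scales hS
  set M := (1 + s) ^ 2 + ε₀ + 2 with hM
  ext p
  simp only [mem_setOf_eq, Set.mem_sdiff]
  constructor
  · rintro ⟨hpW, hhor, ⟨w, hw, hneg⟩, hposw⟩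
    rcases (horizontal_iff hP hN hS hpW).1 hhor with ⟨h0, h1, h2⟩ | ⟨hE₂, hB, hc⟩
    · exfalso
      have hw0 : w ≠ 0 := by rintro rfl; simp at hneg
      have := fderiv_fderiv_subFun_apex_pos hP hN hS h0 h1 h2 hw hw0
      linarith
    · have hev := subFun_eventuallyEq_of_far hP hN hS hB (hN.eq_zero_of_mem_right hE₂)
      have hD2 : fderiv ℝ (fderiv ℝ (subFun F P s δ M)) p = fderiv ℝ (fderiv ℝ F) p := hev.fderiv.fderiv_eq
      rw [hD2] at hneg hposw
      exact ⟨⟨hE₂, hB⟩, hc, ⟨w, hw, hneg⟩, hposw⟩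
  · rintro ⟨⟨hE₂, hB⟩, hc, hneg, hposw⟩
    have hpW : p ∈ subSphere F P E₁ s δ ε₀ := by
      rw [subSphere_eq hP hN hS]; exact Or.inr ⟨hE₂, hB⟩
    have hev := subFun_eventuallyEq_of_far hP hN hS hB (hN.eq_zero_of_mem_right hE₂)
    have hD2 : fderiv ℝ (fderiv ℝ (subFun F P s δ M)) p = fderiv ℝ (fderiv ℝ F) p := hev.fderiv.fderiv_eq
    rw [hD2, hev.fderiv_eq]
    exact ⟨hpW, hc, hneg, hposw⟩

/-- **The horizontal points of the original sphere split**: those of `F` on its zero set are the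
far ones on `E₁`, the far ones on `E₂`, and none in the closed box (the wall is vertical).
[folklore] -/
theorem horizontal_mem_iff (hN : StepNF F E₁ E₂ w₀ η₀ ε₀) (hS : StepScale s δ w₀ η₀)
    {p : EuclideanSpace ℝ (Fin 3)} (hp : F p = 0)
    (hc : ∃ c : ℝ, fderiv ℝ F p = c • innerSL ℝ (EuclideanSpace.single (2 : Fin 3) (1 : ℝ))) :
    p ∉ closedBox s ∧ (p ∈ E₁ ∨ p ∈ E₂) := by
  obtain ⟨c, hc⟩ := hc
  refine ⟨fun hB => fderiv_ne_smul_of_mem_closedBox hN hS hB hp c hc, ?_⟩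
  have : p ∈ E₁ ∪ E₂ := by rw [← hN.hZ]; exact hp
  exact this

end Morse

end CappedBallLid

end Literature.Topology.FourManifolds

end
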